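import Literature.NumberTheory.EllipticCurves.DivisionPolynomialHenselFactorProofs
import Literature.NumberTheory.EllipticCurves.CanonicalSubgroupOfHenselFactorProofs
import Literature.NumberTheory.EllipticCurves.UniversalOrdinaryEllipticProofs
import HarnessLib

/-!
# The canonical subgroup of the universal ordinary curve as a finite group of points
# (Blakestad–Grant 2023, §2.3: `𝒢`, `G`, `φ_ψ = p·Π(x - x(u))`; proofs only)

Trunk T-NT-EC (Literature/NumberTheory/EllipticCurves). Blakestad–Grant (J. Number Theory 249
(2023), arXiv:1903.02480, §2.3): "Since `Ẽ` over `R̂/p` is ordinary, in the kernel of reduction of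
`(𝓔/R̂)^{smooth}` there is a distinguished subgroup (scheme) `𝒢` of order `p`. Let … `G` be the
basechange … over `K`, the fraction field of `R̂` … the roots of `φ_ψ(x)` are precisely the
`x`-coordinates of the non-trivial points in `G`." This file assembles, for the universal
ordinary curve `𝓔 : y² = x³ + A₄x + A₆` over `R̂ = ℤ[A₄,A₆][1/H]^∧_p` (`UniversalOrdinaryRing`),
`p = 2n + 1 ≥ 5`, and any algebraically closed field `F` into which `R̂` embeds:

* **`exists_canonicalSubgroup_universalCurve`** — there are `φ_ψ, ξ_ψ ∈ R̂[X]` and a finite set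
  `G` of `F`-points of `𝓔` such that: `preΨ'_p(𝓔) = φ_ψ·ξ_ψ`, `ξ_ψ` monic of degree `pn`,
  `deg φ_ψ ≤ n`, `(φ_ψ)ₙ = p`, `ℓ̃₀ = φ_ψ(0) ∈ R̂ˣ`, `φ_ψ ≡ ℓ̃₀ (mod p)`, `ℓ̃₀² ≡ H² (mod p)`
  (Blakestad–Grant's (4), the tree's `exists_henselFactor_preΨ'_universalCurve`); and `G` is an
  `IsOddSubgroupFinset` with `#G = p`, `2·#x(G∖O) + 1 = p`, **`φ_ψ = p·veluD G`** over `F` and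
  `P ∈ G ↔ P = O ∨ φ_ψ(x(P)) = 0` (the tree's `exists_canonicalSubgroup_of_henselFactor`, with
  `Δ(𝓔) ≠ 0` from `UniversalOrdinaryEllipticProofs`).

This is the kernel data (`G`, `hG`, `hcard`, `φO = φ_ψ`, `hφF`, `hφ1`, `hℓ`) consumed by
`VeluKernelReductionProofs` on Blakestad–Grant's route (Prop. 7) to the tree's named fact
`WeierstrassCurve.mazur_tate_sigma_existsUnique` (Mazur–Stein–Tate 2006, Thm. 1.3).

## Sources

* C. Blakestad, D. Grant, J. Number Theory 249 (2023) 348–376 (arXiv:1903.02480), §2.1 (`R̂`),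
  §2.3 (the canonical subgroup `𝒢`, `G`, eq. (4), proof of Prop. 7). [BlakestadGrant2023]
* J. H. Silverman, *The Arithmetic of Elliptic Curves*, 2nd ed. (2009), VII.3.1.
  [SilvermanAEC2009]

Pure proof file: no definitions, no named facts.
-/

noncomputable section

open scoped Classical
open Polynomial WeierstrassCurve WeierstrassCurve.Affine.Point

namespace Literature.NumberTheory.EllipticCurves.UniversalOrdinary

variable (p : ℕ) [Fact p.Prime]

/-- **The canonical subgroup of the universal ordinary curve** (Blakestad–Grant's `G` with its
kernel polynomial `p⁻¹φ_ψ`). For `p = 2n + 1 ≥ 5` and an algebraically closed field `F` into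
which `R̂` embeds, there are `φ_ψ, ξ_ψ ∈ R̂[X]` and a finite set `G` of `F`-points of
`𝓔 : y² = x³ + A₄x + A₆` with: `preΨ'_p(𝓔) = φ_ψ·ξ_ψ`, `ξ_ψ` monic of degree `pn`, `deg φ_ψ ≤ n`,
`(φ_ψ)ₙ = p`, `φ_ψ(0) ∈ R̂ˣ`, `(φ_ψ)ᵢ ∈ pR̂` for `i ≥ 1`, `φ_ψ(0)² ≡ H² (mod p)`; `G` is closed
under the group law and negation, contains `O` and no `2`-torsion, `#G = p`, `2·#x(G∖O) + 1 = p`,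
`p·veluD G = φ_ψ` (i.e. `φ_ψ = p·Π_{±u ∈ G∖O}(X - x(u))`), and `P ∈ G ↔ P = O ∨ φ_ψ(x(P)) = 0`.
[Blakestad–Grant 2023, §2.3, eq. (4) and proof of Prop. 7 ("the roots of `φ_ψ(x)` are precisely
the `x`-coordinates of the non-trivial points in `G`")] [cite: BlakestadGrant2023, Prop. 7] -/
theorem exists_canonicalSubgroup_universalCurve (n : ℕ) (hp5 : 5 ≤ p) (hpn : 2 * n + 1 = p)
    {F : Type*} [Field F] [Algebra (completeRing p) F] [IsAlgClosed F]
    (hinj : Function.Injective (algebraMap (completeRing p) F)) :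
    ∃ (φ ξ : (completeRing p)[X])
      (G : Finset ((universalCurve p).map (algebraMap (completeRing p) F)).toAffine.Point),
      (universalCurve p).preΨ' p = φ * ξ ∧ ξ.Monic ∧ ξ.natDegree = p * n ∧ φ.natDegree ≤ n ∧
      φ.coeff n = p ∧ IsUnit (φ.coeff 0) ∧
      (∀ i, 1 ≤ i → φ.coeff i ∈ Ideal.span {(p : completeRing p)}) ∧
      φ.coeff 0 ^ 2 - (universalCurve p).hasseCoeff p ^ 2 ∈ Ideal.span {(p : completeRing p)} ∧
      IsOddSubgroupFinset G ∧ G.card = p ∧ 2 * (veluXVals G).card + 1 = p ∧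
      C (p : F) * veluD G = φ.map (algebraMap (completeRing p) F) ∧
      ∀ P, P ∈ G ↔ P = 0 ∨ (φ.map (algebraMap (completeRing p) F)).eval (xOf P) = 0 := by
  have hp : p.Prime := Fact.out
  obtain ⟨φ, ξ, hfac, hξ, hξdeg, hφn, hφc, hφ0, hφi, hφH⟩ :=
    exists_henselFactor_preΨ'_universalCurve p n hp5 hpn
  haveI := span_natCast_isPrime_completeRing p hp5
  have hker : RingHom.ker (algebraMap (completeRing p) F) ≤ Ideal.span {(p : completeRing p)} := by
    rw [(RingHom.injective_iff_ker_eq_bot _).mp hinj]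
    exact bot_le
  have hn : n ≠ 0 := by omega
  have hφnF : algebraMap (completeRing p) F (φ.coeff n) ≠ 0 := by
    rw [hφc]
    exact fun h => natCast_prime_ne_zero p hp5 (hinj (h.trans (_root_.map_zero _).symm))
  have hΔ : ((universalCurve p).map (algebraMap (completeRing p) F)).Δ ≠ 0 := by
    rw [map_Δ]
    exact fun h => Δ_universalCurve_ne_zero p hp5 (hinj (h.trans (_root_.map_zero _).symm))
  obtain ⟨G, hG, hcard, hX, hD, hmem⟩ := exists_canonicalSubgroup_of_henselFactor
    (V := universalCurve p) rfl (Ideal.span {(p : completeRing p)}) hker hp hpn hfac hξ hφn hφ0 hφi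
    hn hφnF hΔ
  refine ⟨φ, ξ, G, hfac, hξ, hξdeg, hφn, hφc, hφ0, hφi, hφH, hG, hcard, hX, ?_, hmem⟩
  rw [← hD, hφc, _root_.map_natCast (algebraMap (completeRing p) F) p]

end Literature.NumberTheory.EllipticCurves.UniversalOrdinary
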